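import Mathlib.Algebra.MvPolynomial.PDeriv
import Mathlib.RingTheory.MvPolynomial.Homogeneous
import Literature.NumberTheory.Transcendental.AnalytificationImplicit
import Summits.Schanuel.Schanuel.Theorems.ZilberEacComplexOscillatoryBase
import HarnessLib

/-!
# Exponential points over oscillatory graph bases: second-order asymptotics

Third file of the "oscillatory base" sub-rung of Zilber's Exponential-Algebraic Closedness for
`ℂ_exp` in the range `dim π₁(V) = n - 1` (first open rung: Mantova–Masser, PLMS 129 (2024), §1
p. 5). The earlier theorems (`exists_expPoint_punctureDecoupling`, `…punctureBM…`, `…cornerBM…`,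
`exists_expPoint_of_re_leadingForm_neg`) need a lattice direction `q` with `Re g_D(2πi q) < 0`
for the base `x_{s+1} = g(x')`; this fails for *every* `q` exactly when `i^D g_D` is real on
`ℝˢ` (e.g. `g = x₁³ + x₂³`, `g = i x₁ x₂`). Here the sign of `Re g` near the lattice centre
`x₀(m) = 2πi m q + log A(2πi m q)` is decided at the next order,
`Re g(2πi m q + η) = m^{D-1} · (Σⱼ dⱼ Re ∂ⱼg_D(2πi q)) · log m + O(m^{D-1})` for
`Re ηⱼ = dⱼ log m + O(1)`, `Im ηⱼ = O(1)` (`dⱼ = deg Aⱼ`, the growth exponent of `yⱼ = Aⱼ(x')`):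
* `eval_natMul_add_eq_sum_homogeneousComponent` — `g(m v + η) = Σₖ mᵏ gₖ(v + η/m)`;
* `re_eval_le_of_secondOrder_sharp`, `re_eval_le_of_secondOrder` — if `D ≥ 2`, `Re g_D(v) = 0`
  and `κ := Σⱼ dⱼ Re (∂ⱼ g_D)(v) < 0`, then eventually `Re g(m v + η) ≤ (κ/2) m^{D-1} log m ≤ -N log m`
  uniformly on the logarithmic boxes `|Re ηⱼ - dⱼ log m| ≤ C`, `|Im ηⱼ| ≤ C`;
* `exists_expPoint_of_oscillatory` — **EC for oscillatory graph bases** under `D ≥ 2`,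
  `Re g_D(2πi q) = 0`, `(Aⱼ)_{dⱼ}(2πi q) ≠ 0`, `Σⱼ dⱼ Re(∂ⱼ g_D)(2πi q) < 0`.

HONEST FRAMING: a modest new sub-rung of EAC; nothing here bears on Schanuel's conjecture.
-/

noncomputable section

open Complex MvPolynomial Metric Set Filter Topology Asymptotics

set_option linter.dupNamespace false

namespace Summit.Schanuel.Schanuel.Theorems

/-! ### Homogeneous decomposition at `m v + η` -/

/-- `g(m v + η) = Σ_{k ≤ deg g} mᵏ · gₖ(v + η/m)` (`gₖ` the homogeneous components, `m ≠ 0`).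
[folklore] -/
theorem eval_natMul_add_eq_sum_homogeneousComponent {s : ℕ} (g : MvPolynomial (Fin s) ℂ)
    (v η : Fin s → ℂ) {m : ℕ} (hm : m ≠ 0) :
    eval ((fun i => (m : ℂ) * v i) + η) g =
      ∑ k ∈ Finset.range (g.totalDegree + 1),
        (m : ℂ) ^ k * eval (v + (m : ℂ)⁻¹ • η) (homogeneousComponent k g) := by
  have hmC : (m : ℂ) ≠ 0 := by exact_mod_cast hm
  have hx : (fun i => (m : ℂ) * v i) + η = (m : ℂ) • (v + (m : ℂ)⁻¹ • η) := by
    funext i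
    simp only [Pi.add_apply, Pi.smul_apply, smul_eq_mul]
    field_simp
  rw [hx]
  conv_lhs => rw [← sum_homogeneousComponent g]
  rw [map_sum]
  refine Finset.sum_congr rfl fun k _ => ?_
  exact (homogeneousComponent_isHomogeneous k g).eval_smul_eq _ _

/-! ### The second-order upper bound -/

/-- Real part of `Σⱼ cⱼ ηⱼ` on a logarithmic box: if `|Re ηⱼ - dⱼ ℓ| ≤ C` and `|Im ηⱼ| ≤ C` then
`Re Σⱼ cⱼ ηⱼ ≤ (Σⱼ dⱼ Re cⱼ) ℓ + C Σⱼ (|Re cⱼ| + |Im cⱼ|)`. [folklore] -/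
theorem re_sum_mul_le_of_box {s : ℕ} (c η : Fin s → ℂ) (d : Fin s → ℕ) (C ℓ : ℝ)
    (hre : ∀ j, |(η j).re - d j * ℓ| ≤ C) (him : ∀ j, |(η j).im| ≤ C) :
    (∑ j, c j * η j).re ≤
      (∑ j, (d j : ℝ) * (c j).re) * ℓ + C * ∑ j, (|(c j).re| + |(c j).im|) := by
  rw [Complex.re_sum, Finset.sum_mul, Finset.mul_sum, ← Finset.sum_add_distrib]
  refine Finset.sum_le_sum fun j _ => ?_
  rw [Complex.mul_re]
  have h1 : (c j).re * ((η j).re - d j * ℓ) ≤ |(c j).re| * C := by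
    refine (le_abs_self _).trans ?_
    rw [abs_mul]
    exact mul_le_mul_of_nonneg_left (hre j) (abs_nonneg _)
  have h2 : -((c j).im * (η j).im) ≤ |(c j).im| * C := by
    refine (neg_le_abs _).trans ?_
    rw [abs_mul]
    exact mul_le_mul_of_nonneg_left (him j) (abs_nonneg _)
  have h3 : (c j).re * (η j).re =
      (d j : ℝ) * (c j).re * ℓ + (c j).re * ((η j).re - d j * ℓ) := by ring
  rw [h3]
  linarith

/-- Sup-norm of a vector in a logarithmic box: `|Re ηⱼ - dⱼ ℓ| ≤ C`, `|Im ηⱼ| ≤ C`, `ℓ, C ≥ 0`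
give `‖η‖ ≤ (Σⱼ dⱼ) ℓ + 2C`. [folklore] -/
theorem norm_le_of_box {s : ℕ} (η : Fin s → ℂ) (d : Fin s → ℕ) {C ℓ : ℝ} (hC : 0 ≤ C)
    (hℓ : 0 ≤ ℓ) (hre : ∀ j, |(η j).re - d j * ℓ| ≤ C) (him : ∀ j, |(η j).im| ≤ C) :
    ‖η‖ ≤ (∑ j, (d j : ℝ)) * ℓ + 2 * C := by
  have hSd0 : 0 ≤ ∑ j, (d j : ℝ) := Finset.sum_nonneg fun j _ => Nat.cast_nonneg _
  refine (pi_norm_le_iff_of_nonneg (by positivity)).2 fun j => ?_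
  have h1 := Complex.norm_le_abs_re_add_abs_im (η j)
  have h2 : |(η j).re| ≤ d j * ℓ + C := by
    have := abs_sub_abs_le_abs_sub (η j).re (d j * ℓ)
    have h4 : |(d j : ℝ) * ℓ| = d j * ℓ := abs_of_nonneg (by positivity)
    linarith [hre j]
  have hdle : (d j : ℝ) ≤ ∑ i, (d i : ℝ) :=
    Finset.single_le_sum (f := fun i => (d i : ℝ)) (fun i _ => Nat.cast_nonneg _)
      (Finset.mem_univ j)
  have h3 : (d j : ℝ) * ℓ ≤ (∑ i, (d i : ℝ)) * ℓ := mul_le_mul_of_nonneg_right hdle hℓ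
  linarith [him j]

/-- **Second-order upper bound for `Re g` near a lattice ray.** Let `g ∈ ℂ[x₁..xₛ]` have total
degree `D ≥ 2` and leading form `g_D` with `Re g_D(v) = 0`, and let `dⱼ ∈ ℕ`, `C ≥ 0` with
`κ := Σⱼ dⱼ · Re (∂ⱼ g_D)(v) < 0`. Then (sharp form) for all large `m ∈ ℕ` and all `η` in the
logarithmic box `|Re ηⱼ - dⱼ log m| ≤ C`, `|Im ηⱼ| ≤ C` (`j ≤ s`):
`Re g(m v + η) ≤ (κ/2) · m^{D-1} · log m`. Indeed `g(m v + η) = Σₖ mᵏ gₖ(v + η/m)` and the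
first-order Taylor expansion of `g_D` at `v` (`Literature.NumberTheory.Transcendental.hasFDerivAt_eval`)
give `Re g(m v + η) = m^{D-1}(κ log m + O(1)) + o(m^{D-1} log m)`. New (the second-order step for
oscillatory bases of the first open rung of Exponential-Algebraic Closedness, Mantova–Masser 2024
§1 p. 5). [cite: MantovaMasser2023, §1 p.5 (the open case dim π(V) = 2 in ℂ³×ℂˣ³)] -/
theorem re_eval_le_of_secondOrder_sharp {s : ℕ} (g : MvPolynomial (Fin s) ℂ) (v : Fin s → ℂ)
    (hD : 2 ≤ g.totalDegree)
    (hre : (eval v (homogeneousComponent g.totalDegree g)).re = 0)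
    (d : Fin s → ℕ) {C : ℝ} (hC : 0 ≤ C)
    (hκ : ∑ j, (d j : ℝ) *
      (eval v (pderiv j (homogeneousComponent g.totalDegree g))).re < 0) :
    ∀ᶠ m : ℕ in atTop, ∀ η : Fin s → ℂ,
      (∀ j, |(η j).re - d j * Real.log m| ≤ C) → (∀ j, |(η j).im| ≤ C) →
      (eval ((fun i => (m : ℂ) * v i) + η) g).re ≤
        (∑ j, (d j : ℝ) * (eval v (pderiv j (homogeneousComponent g.totalDegree g))).re) / 2 *
          (m : ℝ) ^ (g.totalDegree - 1) * Real.log m := by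
  classical
  obtain ⟨E, hE⟩ : ∃ E, g.totalDegree = E + 1 + 1 := ⟨g.totalDegree - 2, by omega⟩
  have hE1 : g.totalDegree - 1 = E + 1 := by omega
  rw [hE1]
  rw [hE] at hre hκ ⊢
  -- names
  set gD : MvPolynomial (Fin s) ℂ := homogeneousComponent (E + 1 + 1) g with hgD
  set gD1 : MvPolynomial (Fin s) ℂ := homogeneousComponent (E + 1) g with hgD1
  set c : Fin s → ℂ := fun j => eval v (pderiv j gD) with hc
  set κ : ℝ := ∑ j, (d j : ℝ) * (c j).re with hκdef
  have hκ0 : κ < 0 := hκ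
  set Sd : ℝ := ∑ j, (d j : ℝ) with hSd
  have hSd0 : 0 ≤ Sd := Finset.sum_nonneg fun j _ => Nat.cast_nonneg _
  -- ### (a) first-order Taylor expansion of the leading form at `v`
  set L : (Fin s → ℂ) →L[ℂ] ℂ :=
    ∑ i, eval v (pderiv i gD) • (ContinuousLinearMap.proj i : (Fin s → ℂ) →L[ℂ] ℂ) with hL
  have hLapp : ∀ h : Fin s → ℂ, L h = ∑ j, c j * h j := fun h => by
    simp [hL, hc]
  have hfd : HasFDerivAt (fun w : Fin s → ℂ => eval w gD) L v :=
    Literature.NumberTheory.Transcendental.hasFDerivAt_eval _ v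
  set ε : ℝ := -κ / (4 * (Sd + 1)) with hεdef
  have hε : 0 < ε := by rw [hεdef]; exact div_pos (by linarith) (by positivity)
  have hεSd : ε * Sd ≤ -κ / 4 := by
    rw [hεdef, div_mul_eq_mul_div, div_le_iff₀ (by positivity)]
    nlinarith
  obtain ⟨δ, hδ, hδε⟩ : ∃ δ > 0, ∀ h : Fin s → ℂ, ‖h‖ < δ →
      ‖eval (v + h) gD - eval v gD - L h‖ ≤ ε * ‖h‖ := by
    have h1 := (hasFDerivAt_iff_isLittleO_nhds_zero.mp hfd).def hε
    obtain ⟨δ, hδ, h2⟩ := Metric.eventually_nhds_iff.mp h1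
    exact ⟨δ, hδ, fun h hh => h2 (by rwa [dist_zero_right])⟩
  -- ### (b) continuity of `g_{D-1}` at `v`
  obtain ⟨δ', hδ', hδ'1⟩ : ∃ δ' > 0, ∀ h : Fin s → ℂ, ‖h‖ < δ' →
      ‖eval (v + h) gD1 - eval v gD1‖ < 1 := by
    have hcont : ContinuousAt (fun w : Fin s → ℂ => eval w gD1) v :=
      (MvPolynomial.continuous_eval _).continuousAt
    obtain ⟨δ', hδ', h⟩ := Metric.continuousAt_iff.mp hcont 1 one_pos
    refine ⟨δ', hδ', fun h' hh => ?_⟩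
    have := h (x := v + h') (by rwa [dist_eq_norm, add_sub_cancel_left])
    rwa [dist_eq_norm] at this
  -- ### (c) bounds for the lower components on `‖h‖ ≤ 1`
  have hB : ∀ k : ℕ, ∃ B : ℝ, 0 ≤ B ∧ ∀ h : Fin s → ℂ, ‖h‖ ≤ 1 →
      ‖eval (v + h) (homogeneousComponent k g)‖ ≤ B := by
    intro k
    obtain ⟨C', hC', N', hCN⟩ :=
      Literature.NumberTheory.Transcendental.HypersurfaceCover.exists_norm_eval_le_pow
        (homogeneousComponent k g)
    refine ⟨C' * (2 + ‖v‖) ^ N', by positivity, fun h hh => (hCN (v + h)).trans ?_⟩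
    have hle : 1 + ‖v + h‖ ≤ 2 + ‖v‖ := by have := norm_add_le v h; linarith
    exact mul_le_mul_of_nonneg_left (pow_le_pow_left₀ (by positivity) hle N') hC'
  choose B hB0 hBle using hB
  set SB : ℝ := ∑ k ∈ Finset.range (E + 1), B k with hSB
  have hSB0 : 0 ≤ SB := Finset.sum_nonneg fun k _ => hB0 k
  -- ### (d) constants and the eventual requirements on `m`
  set C₁ : ℝ := C * ∑ j, (|(c j).re| + |(c j).im|) with hC₁
  set C₂ : ℝ := ‖eval v gD1‖ + 1 + C₁ + 2 * C * ε + SB with hC₂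
  set δ₀ : ℝ := min (min δ δ') 1 with hδ₀
  have hδ₀pos : 0 < δ₀ := lt_min (lt_min hδ hδ') one_pos
  have hδ₀δ : δ₀ ≤ δ := (min_le_left _ _).trans (min_le_left _ _)
  have hδ₀δ' : δ₀ ≤ δ' := (min_le_left _ _).trans (min_le_right _ _)
  have hδ₀1 : δ₀ ≤ 1 := min_le_right _ _
  have hev1 : ∀ᶠ m : ℕ in atTop, Sd * Real.log m + 2 * C ≤ δ₀ / 2 * m :=
    eventually_mul_log_add_le Sd (2 * C) (half_pos hδ₀pos)
  have hev2 : ∀ᶠ m : ℕ in atTop, C₂ ≤ -κ / 4 * Real.log m :=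
    ((Real.tendsto_log_atTop.comp tendsto_natCast_atTop_atTop).const_mul_atTop
      (by linarith : 0 < -κ / 4)).eventually_ge_atTop C₂
  filter_upwards [hev1, hev2, eventually_ge_atTop 1] with m hm1 hm2 hm_one
  intro η hηre hηim
  have hm1' : (1 : ℝ) ≤ m := by exact_mod_cast hm_one
  have hm0 : (0 : ℝ) < m := by linarith
  have hlog0 : 0 ≤ Real.log m := Real.log_nonneg hm1'
  -- ### size of `η` and of `ζ = η / m`
  have hηn : ‖η‖ ≤ Sd * Real.log m + 2 * C := norm_le_of_box η d hC hlog0 hηre hηim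
  set ζ : Fin s → ℂ := (m : ℂ)⁻¹ • η with hζ
  have hζnorm : ‖ζ‖ = (m : ℝ)⁻¹ * ‖η‖ := by
    rw [hζ, norm_smul, norm_inv, Complex.norm_natCast]
  have hζn : ‖ζ‖ ≤ δ₀ / 2 := by
    rw [hζnorm, inv_mul_le_iff₀ hm0]
    linarith
  have hζδ : ‖ζ‖ < δ := by linarith
  have hζδ' : ‖ζ‖ < δ' := by linarith
  have hζ1 : ‖ζ‖ ≤ 1 := by linarith
  -- ### the decomposition
  have hdec := eval_natMul_add_eq_sum_homogeneousComponent g v η (m := m) (by omega)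
  rw [hE, Finset.sum_range_succ, Finset.sum_range_succ] at hdec
  have hmre : ∀ (k : ℕ) (z : ℂ), ((m : ℂ) ^ k * z).re = (m : ℝ) ^ k * z.re := by
    intro k z
    have : (m : ℂ) ^ k = (((m : ℝ) ^ k : ℝ) : ℂ) := by push_cast; rfl
    rw [this, Complex.re_ofReal_mul]
  have hmnorm : ∀ (k : ℕ) (z : ℂ), ‖(m : ℂ) ^ k * z‖ = (m : ℝ) ^ k * ‖z‖ := by
    intro k z; rw [norm_mul, norm_pow, Complex.norm_natCast]
  have hmE : (0 : ℝ) ≤ (m : ℝ) ^ (E + 1) := by positivity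
  -- (T0) the lower components
  have hT0 : (∑ k ∈ Finset.range (E + 1),
      (m : ℂ) ^ k * eval (v + ζ) (homogeneousComponent k g)).re ≤ (m : ℝ) ^ (E + 1) * SB := by
    refine (Complex.re_le_norm _).trans ((norm_sum_le _ _).trans ?_)
    calc ∑ k ∈ Finset.range (E + 1), ‖(m : ℂ) ^ k * eval (v + ζ) (homogeneousComponent k g)‖
        ≤ ∑ k ∈ Finset.range (E + 1), (m : ℝ) ^ (E + 1) * B k := by
          refine Finset.sum_le_sum fun k hk => ?_
          rw [hmnorm]
          have hk' : k ≤ E + 1 := by have := Finset.mem_range.mp hk; omega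
          exact mul_le_mul (pow_le_pow_right₀ hm1' hk') (hBle k ζ hζ1) (norm_nonneg _) hmE
      _ = (m : ℝ) ^ (E + 1) * SB := by rw [hSB, Finset.mul_sum]
  -- (T1) the component of degree `D - 1`
  have hT1 : ((m : ℂ) ^ (E + 1) * eval (v + ζ) gD1).re ≤
      (m : ℝ) ^ (E + 1) * (‖eval v gD1‖ + 1) := by
    refine (Complex.re_le_norm _).trans ?_
    rw [hmnorm]
    refine mul_le_mul_of_nonneg_left ?_ hmE
    have h1 := hδ'1 ζ hζδ'
    have h2 := norm_le_norm_add_norm_sub' (eval (v + ζ) gD1) (eval v gD1)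
    linarith
  -- (T2) the leading component: Taylor expansion
  set R : ℂ := eval (v + ζ) gD - eval v gD - L ζ with hR
  have hRb : ‖R‖ ≤ ε * ‖ζ‖ := hδε ζ hζδ
  have hLζ : (m : ℂ) ^ (E + 1 + 1) * L ζ = (m : ℂ) ^ (E + 1) * L η := by
    have hmC : (m : ℂ) ≠ 0 := by exact_mod_cast hm0.ne'
    rw [hζ, map_smul, smul_eq_mul, pow_succ]
    field_simp
  have hT2eq : (m : ℂ) ^ (E + 1 + 1) * eval (v + ζ) gD =
      (m : ℂ) ^ (E + 1 + 1) * eval v gD + (m : ℂ) ^ (E + 1) * L η +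
        (m : ℂ) ^ (E + 1 + 1) * R := by
    rw [← hLζ, hR]; ring
  have hLre : (L η).re ≤ κ * Real.log m + C₁ := by
    rw [hLapp]
    exact re_sum_mul_le_of_box c η d C (Real.log m) hηre hηim
  have hRre : (m : ℝ) ^ (E + 1 + 1) * R.re ≤ (m : ℝ) ^ (E + 1) * (ε * ‖η‖) := by
    have h1 : (m : ℝ) ^ (E + 1 + 1) * R.re ≤ (m : ℝ) ^ (E + 1 + 1) * ‖R‖ :=
      mul_le_mul_of_nonneg_left (Complex.re_le_norm R) (by positivity)
    have h2 : (m : ℝ) ^ (E + 1 + 1) * (ε * ‖ζ‖) = (m : ℝ) ^ (E + 1) * (ε * ‖η‖) := by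
      rw [hζnorm, pow_succ]
      field_simp
    rw [← h2]
    exact h1.trans (mul_le_mul_of_nonneg_left hRb (by positivity))
  have hT2 : ((m : ℂ) ^ (E + 1 + 1) * eval (v + ζ) gD).re ≤
      (m : ℝ) ^ (E + 1) * (κ * Real.log m + C₁) + (m : ℝ) ^ (E + 1) * (ε * ‖η‖) := by
    rw [hT2eq]
    simp only [Complex.add_re, hmre, hre, mul_zero, zero_add]
    exact add_le_add (mul_le_mul_of_nonneg_left hLre hmE) hRre
  -- ### summation
  have htot : (eval ((fun i => (m : ℂ) * v i) + η) g).re =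
      (∑ k ∈ Finset.range (E + 1),
          (m : ℂ) ^ k * eval (v + ζ) (homogeneousComponent k g)).re +
        ((m : ℂ) ^ (E + 1) * eval (v + ζ) gD1).re +
        ((m : ℂ) ^ (E + 1 + 1) * eval (v + ζ) gD).re := by
    rw [hdec, Complex.add_re, Complex.add_re]
  clear hdec hT2eq
  have hεη : (m : ℝ) ^ (E + 1) * (ε * ‖η‖) ≤
      (m : ℝ) ^ (E + 1) * (-κ / 4 * Real.log m + 2 * C * ε) := by
    refine mul_le_mul_of_nonneg_left ?_ hmE
    have h1 : ε * ‖η‖ ≤ ε * (Sd * Real.log m + 2 * C) := mul_le_mul_of_nonneg_left hηn hε.le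
    have h2 := mul_le_mul_of_nonneg_right hεSd hlog0
    have h3 : ε * (Sd * Real.log m + 2 * C) = ε * Sd * Real.log m + 2 * C * ε := by ring
    linarith
  have hfin : (m : ℝ) ^ (E + 1) *
      (SB + (‖eval v gD1‖ + 1) + (κ * Real.log m + C₁) + (-κ / 4 * Real.log m + 2 * C * ε)) ≤
      (m : ℝ) ^ (E + 1) * (κ / 2 * Real.log m) := by
    refine mul_le_mul_of_nonneg_left ?_ hmE
    rw [hC₂] at hm2
    linarith
  have hring : (m : ℝ) ^ (E + 1) * (κ / 2 * Real.log m) =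
      κ / 2 * (m : ℝ) ^ (E + 1) * Real.log m := by ring
  have hexp : (m : ℝ) ^ (E + 1) *
      (SB + (‖eval v gD1‖ + 1) + (κ * Real.log m + C₁) + (-κ / 4 * Real.log m + 2 * C * ε)) =
      (m : ℝ) ^ (E + 1) * SB + (m : ℝ) ^ (E + 1) * (‖eval v gD1‖ + 1) +
        (m : ℝ) ^ (E + 1) * (κ * Real.log m + C₁) +
        (m : ℝ) ^ (E + 1) * (-κ / 4 * Real.log m + 2 * C * ε) := by ring
  linarith [hT0, hT1, hT2, htot, hεη, hfin, hring, hexp]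

/-- **Second-order upper bound, `-N log m` form.** Under the hypotheses of
`re_eval_le_of_secondOrder_sharp`, for every `N ∈ ℕ`, for all large `m` and all `η` in the
logarithmic box, `Re g(m v + η) ≤ -N log m` (since `(κ/2) m^{D-1} log m ≤ -N log m` once
`(-κ/2) m ≥ N`). [cite: MantovaMasser2023, §1 p.5 (the open case dim π(V) = 2 in ℂ³×ℂˣ³)] -/
theorem re_eval_le_of_secondOrder {s : ℕ} (g : MvPolynomial (Fin s) ℂ) (v : Fin s → ℂ)
    (hD : 2 ≤ g.totalDegree)
    (hre : (eval v (homogeneousComponent g.totalDegree g)).re = 0)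
    (d : Fin s → ℕ) {C : ℝ} (hC : 0 ≤ C)
    (hκ : ∑ j, (d j : ℝ) *
      (eval v (pderiv j (homogeneousComponent g.totalDegree g))).re < 0) (N : ℕ) :
    ∀ᶠ m : ℕ in atTop, ∀ η : Fin s → ℂ,
      (∀ j, |(η j).re - d j * Real.log m| ≤ C) → (∀ j, |(η j).im| ≤ C) →
      (eval ((fun i => (m : ℂ) * v i) + η) g).re ≤ -(N * Real.log m) := by
  set κ : ℝ := ∑ j, (d j : ℝ) *
    (eval v (pderiv j (homogeneousComponent g.totalDegree g))).re with hκdef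
  have hev3 : ∀ᶠ m : ℕ in atTop, (N : ℝ) ≤ -κ / 2 * m :=
    (tendsto_natCast_atTop_atTop.const_mul_atTop (by linarith : 0 < -κ / 2)).eventually_ge_atTop _
  filter_upwards [re_eval_le_of_secondOrder_sharp g v hD hre d hC hκ, hev3, eventually_ge_atTop 1]
    with m hm hm3 hm_one
  intro η hηre hηim
  have h := hm η hηre hηim
  have hm1' : (1 : ℝ) ≤ m := by exact_mod_cast hm_one
  have hlog0 : 0 ≤ Real.log m := Real.log_nonneg hm1'
  have hpow : (m : ℝ) ≤ (m : ℝ) ^ (g.totalDegree - 1) := le_self_pow₀ hm1' (by omega)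
  have hN : (N : ℝ) * Real.log m ≤ -κ / 2 * (m : ℝ) ^ (g.totalDegree - 1) * Real.log m := by
    refine mul_le_mul_of_nonneg_right ?_ hlog0
    exact hm3.trans (mul_le_mul_of_nonneg_left hpow (by linarith))
  linarith

/-! ### EC for oscillatory graph bases -/

/-- **Exponential points over oscillatory graph bases.** Let `q ∈ ℤˢ`, `v = 2πi q`,
`g ∈ ℂ[x₁..xₛ]` of total degree `D ≥ 2` with leading form `g_D` such that `Re g_D(v) = 0`
(e.g. every `q` when `g = x₁³ + x₂³` or `g = i x₁ x₂`), `Aⱼ ∈ ℂ[x₁..xₛ]` with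
`(Aⱼ)_{dⱼ}(v) ≠ 0` (`dⱼ = deg Aⱼ`), `Fⱼ ∈ ℂ[u, x₁..xₛ]` arbitrary, and assume the
**second-order sign condition** `Σⱼ dⱼ · Re (∂ⱼ g_D)(v) < 0`. Then for all large `m` the system
`exp xⱼ = Aⱼ(x) + e^{g(x)} Fⱼ(e^{g(x)}, x)` (`j ≤ s`) has a solution within sup-distance `1/2`
of the lattice centre `x₀(m) = (2πi m qⱼ + log Aⱼ(2πi m q))ⱼ`. Equivalently the `(s+1)`-fold
`V = {x_{s+1} = g(x'), yⱼ = Aⱼ(x') + y_{s+1} Fⱼ(y_{s+1}, x')} ⊆ ℂ^{s+1} × (ℂˣ)^{s+1}` — additive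
projection the graph hypersurface `x_{s+1} = g`, `dim π₁ V = n - 1`, the first open range of
Exponential-Algebraic Closedness (Mantova–Masser 2024 §1 p. 5; outside Brownawell–Masser 2017
Prop. 2, Mantova–Masser Thm 1.1 and Gallinaro 2023 Thm 8.8) — meets the graph of `exp` in
infinitely many points. Mechanism: the fibre forces `Re xⱼ = log |Aⱼ| ≈ dⱼ log m`, and then
`Re g ≈ κ m^{D-1} log m → -∞` (`re_eval_le_of_secondOrder`), so `y_{s+1} = e^{g}` still tends to
the puncture `0` super-polynomially although the leading order oscillates. New; the first case of
EAC over graph bases with no lattice direction of negative leading real part (e.g. the cubic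
analogue `e^z + e^{z³+w³} = z, e^w + e^{z³+w³} = -w` of Mantova–Masser's model system).
[cite: MantovaMasser2023, §1 p.5 (the open case dim π(V) = 2 in ℂ³×ℂˣ³)] -/
theorem exists_expPoint_of_oscillatory {s : ℕ} (g : MvPolynomial (Fin s) ℂ)
    (hD : 2 ≤ g.totalDegree) (q : Fin s → ℤ)
    (hre : (eval (fun j => 2 * Real.pi * I * (q j : ℂ))
      (homogeneousComponent g.totalDegree g)).re = 0)
    (A : Fin s → MvPolynomial (Fin s) ℂ)
    (hA : ∀ j, eval (fun i => 2 * Real.pi * I * (q i : ℂ))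
      (homogeneousComponent (A j).totalDegree (A j)) ≠ 0)
    (hκ : ∑ j, ((A j).totalDegree : ℝ) * (eval (fun i => 2 * Real.pi * I * (q i : ℂ))
      (pderiv j (homogeneousComponent g.totalDegree g))).re < 0)
    (F : Fin s → MvPolynomial (Fin (s + 1)) ℂ) :
    ∀ᶠ m : ℕ in atTop, ∃ x : Fin s → ℂ,
      ‖x - fun i => (m : ℂ) * (2 * Real.pi * I * (q i : ℂ)) +
          log (eval (fun k => (m : ℂ) * (2 * Real.pi * I * (q k : ℂ))) (A i))‖ ≤ 1 / 2 ∧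
      ∀ j, exp (x j) = eval x (A j) +
        exp (eval x g) * eval (Fin.cons (exp (eval x g)) x) (F j) := by
  classical
  refine exists_expPoint_of_superlog_decay g q A hA F fun N => ?_
  set v : Fin s → ℂ := fun j => 2 * Real.pi * I * (q j : ℂ) with hv
  set a : Fin s → ℝ := fun j => ‖eval v (homogeneousComponent (A j).totalDegree (A j))‖ with ha
  set C : ℝ := 1 + Real.pi + ∑ j, (|Real.log (a j / 2)| + |Real.log (2 * a j)|) with hCdef
  have hsum0 : 0 ≤ ∑ j, (|Real.log (a j / 2)| + |Real.log (2 * a j)|) :=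
    Finset.sum_nonneg fun j _ => by positivity
  have hC0 : 0 ≤ C := by have := Real.pi_pos; rw [hCdef]; positivity
  have hCj : ∀ j, |Real.log (a j / 2)| + |Real.log (2 * a j)| ≤
      ∑ i, (|Real.log (a i / 2)| + |Real.log (2 * a i)|) := fun j =>
    Finset.single_le_sum (f := fun i => |Real.log (a i / 2)| + |Real.log (2 * a i)|)
      (fun i _ => by positivity) (Finset.mem_univ j)
  have hbox := re_eval_le_of_secondOrder g v hD hre (fun j => (A j).totalDegree) hC0 hκ N
  filter_upwards [hbox, eventually_all.2 fun j => latticeValue_eventually (A j) v (hA j)]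
    with m hm hlv
  intro ξ hξ
  set η : Fin s → ℂ := (fun i => log (eval (fun k => (m : ℂ) * v k) (A i))) + ξ with hη
  have hsplit : (fun i => (m : ℂ) * v i + log (eval (fun k => (m : ℂ) * v k) (A i))) + ξ =
      (fun i => (m : ℂ) * v i) + η := by
    funext i; simp only [hη, Pi.add_apply]; ring
  rw [hsplit]
  have hξj : ∀ j, ‖ξ j‖ ≤ 1 := fun j => (norm_le_pi_norm ξ j).trans hξ
  refine hm η (fun j => ?_) (fun j => ?_)
  · -- real parts: `Re ηⱼ = log ‖Aⱼ(m v)‖ + Re ξⱼ`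
    obtain ⟨-, ⟨h1, h2⟩, -⟩ := hlv j
    have hre' : (η j).re = Real.log ‖eval (fun k => (m : ℂ) * v k) (A j)‖ + (ξ j).re := by
      simp only [hη, Pi.add_apply, Complex.add_re, Complex.log_re]
    have h3 : |(ξ j).re| ≤ 1 := (Complex.abs_re_le_norm _).trans (hξj j)
    rw [hre', abs_le]
    rw [abs_le] at h3
    have h4 : -|Real.log (a j / 2)| ≤ Real.log (a j / 2) := neg_abs_le _
    have h5 : Real.log (2 * a j) ≤ |Real.log (2 * a j)| := le_abs_self _
    have h6 := hCj j
    have h7 : 0 ≤ |Real.log (2 * a j)| := abs_nonneg _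
    have h8 : 0 ≤ |Real.log (a j / 2)| := abs_nonneg _
    have hpi := Real.pi_pos
    constructor <;> linarith
  · -- imaginary parts: `Im ηⱼ = arg Aⱼ(m v) + Im ξⱼ`
    have him' : (η j).im = arg (eval (fun k => (m : ℂ) * v k) (A j)) + (ξ j).im := by
      simp only [hη, Pi.add_apply, Complex.add_im, Complex.log_im]
    have h3 : |(ξ j).im| ≤ 1 := (Complex.abs_im_le_norm _).trans (hξj j)
    have h4 : |arg (eval (fun k => (m : ℂ) * v k) (A j))| ≤ Real.pi := Complex.abs_arg_le_pi _
    rw [him']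
    refine (abs_add_le _ _).trans ?_
    rw [hCdef]
    linarith

end Summit.Schanuel.Schanuel.Theorems
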